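import Summits.ValiantsHypothesis.ValiantsHypothesis.Theses.UnpaddedGIT
import Literature.Computability.AlgebraicComplexity.PermanentVsDeterminantProofs
import Literature.Computability.AlgebraicComplexity.DeterminantalComplexityProofs

/-!
# Route UnpaddedGIT — support item `GrenetPencil`

`per_n ∈ D_(2ⁿ − 1)(n)` for `n ≥ 1`: the permanent is the degree-`n` homogeneous component of
the determinant of some `(2ⁿ − 1) × (2ⁿ − 1)` matrix of affine linear forms in its own `n²`
variables. This is Grenet's bound `dc(per_n) ≤ 2ⁿ − 1` (tree:
`determinantalComplexity_perPoly_le_holds`), attainment of `dc`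
(`hasDetRepr_determinantalComplexity_holds`), padding (`HasDetRepr.mono_holds`), and the fact that
`per_n` is homogeneous of degree `n`, so that `hc_n (det A) = hc_n (per_n) = per_n`.
-/

-- single-conjunct layout: Sub = Summit, duplicated namespace component intended
set_option linter.dupNamespace false

namespace Summit.ValiantsHypothesis.ValiantsHypothesis.Theorems

open MvPolynomial Literature.Computability.AlgebraicComplexity

/-- **GrenetPencil** (route UnpaddedGIT, junk guard on the upper side): for every `n ≥ 1` the
permanent `per_n` lies in the pencil-coefficient family `D_(2ⁿ − 1)(n)`, i.e. there is a
`(2ⁿ − 1) × (2ⁿ − 1)` matrix `A` of affine linear forms in the variables `x_ij` with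
`hc_n (det A) = per_n`. Proof: Grenet's `dc(per_n) ≤ 2ⁿ − 1` gives an affine `A` of that size
with `det A = per_n` (attainment + padding), and `per_n` is homogeneous of degree `n`. -/
theorem grenetPencil_proof : Theses.UnpaddedGIT.GrenetPencil := by
  unfold Theses.UnpaddedGIT.GrenetPencil
  intro n hn
  -- Grenet: `dc(per_n) ≤ 2 ^ n - 1`, attained and padded to size exactly `2 ^ n - 1`
  have hdc : determinantalComplexity (perPoly (Fin n) ℂ) ≤ 2 ^ n - 1 :=
    determinantalComplexity_perPoly_le_holds ℂ n hn
  have hrepr : HasDetRepr (perPoly (Fin n) ℂ) (2 ^ n - 1) :=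
    HasDetRepr.mono_holds (hasDetRepr_determinantalComplexity_holds (perPoly (Fin n) ℂ)) hdc
  obtain ⟨A, hA, hdet⟩ := hrepr
  refine ⟨A, hA, ?_⟩
  rw [hdet]
  -- `per_n` is homogeneous of degree `n`, so its degree-`n` component is itself
  have hhom : (perPoly (Fin n) ℂ).IsHomogeneous n := by
    simpa using perPoly_isHomogeneous (n := Fin n) (k := ℂ)
  rw [homogeneousComponent_of_mem hhom, if_pos rfl]

end Summit.ValiantsHypothesis.ValiantsHypothesis.Theorems
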